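import Summits.QuantumFields.YangMills.Theorems.SmallCircleAnchorAnchorGapStubDebyeScreening19
import Summits.QuantumFields.YangMills.Theorems.SmallCircleAnchorAnchorGapStubDebyeScreening23

/-!
# Crux `AnchorGap` (stmt-QuantumFields-11141), line `registered` — the Gaussian heat equation along a covariance segment (stub HEAT)

For a segment of COVARIANCES `C(t) = C₀ + tB` (positive definite at `t₀`) the centred Gaussian
with precision `C(t)⁻¹` satisfies the heat equation
`d/dt ⟨F⟩_{C(t)} |_{t₀} = ½ Σ_{a,b} B_{ab} ⟨∂_a∂_b F⟩_{C(t₀)}`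
for `F` in the polynomial-growth class (Glimm–Jaffe (9.1.33): `d/dt ∫ F dφ_{C(t)} = ½ ∫ Δ_{Ċ} F dφ_{C(t)}`).
Unlike the precision-segment version `hasDerivAt_gaussian_expect` of `…StubDebyeScreening19`, the
derivative `Ċ = B` enters linearly and without sandwiches; this is why the
Battle–Brydges–Federbush cluster expansion interpolates covariances.

* `hasDerivAt_gaussian_integral_path` — differentiation under the integral sign along an arbitrary
  precision path `t ↦ P(t)`, continuous at `t₀` together with its entrywise derivative `P'` and
  differentiable near `t₀`: `d/dt ∫ F e^{−½φᵀP(t)φ} = −½ ∫ (φᵀP'(t₀)φ) F e^{−½φᵀP(t₀)φ}`;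
* `hasDerivAt_gaussianCov_integral` — the case `P(t) = (C₀ + tB)⁻¹`, `P' = −PBP`
  (`hasDerivAt_matrix_inv_linear`): `d/dt ∫ F e^{−½φᵀC(t)⁻¹φ} = ½ ∫ (φᵀPBPφ) F e^{−½φᵀPφ}`;
* `stub_gaussianCovHeat` — the heat equation for normalised expectations (quotient rule and
  `gaussian_wick_quadForm` with the insertion `PBP`, whose sandwich `C(PBP)C = B` collapses).
-/

set_option autoImplicit false

noncomputable section

namespace Summit.QuantumFields.YangMills.Theorems.AnchorGap

open MeasureTheory Finset Matrix Filter
open scoped Topology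

/-- The quadratic form of a matrix as a double sum over its entries. -/
private lemma quadForm_eq_sum_entries {ι : Type} [Fintype ι] (M : Matrix ι ι ℝ) (φ : ι → ℝ) :
    φ ⬝ᵥ (M *ᵥ φ) = ∑ p, ∑ q, M p q * (φ p * φ q) := by
  simp only [dotProduct, Matrix.mulVec, Finset.mul_sum]
  exact Finset.sum_congr rfl fun p _ => Finset.sum_congr rfl fun q _ => by ring

/-- `|φᵀMφ| ≤ (Σ_{pq} |M_{pq}|) Σᵢ φᵢ²`. -/
private lemma abs_quadForm_le_entries {ι : Type} [Fintype ι] (D : Matrix ι ι ℝ) (φ : ι → ℝ) :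
    |φ ⬝ᵥ (D *ᵥ φ)| ≤ (∑ p, ∑ q, |D p q|) * ∑ i, φ i ^ 2 := by
  have hs : ∀ j, φ j ^ 2 ≤ ∑ i, φ i ^ 2 := fun j =>
    Finset.single_le_sum (f := fun i => φ i ^ 2) (fun i _ => sq_nonneg _) (Finset.mem_univ j)
  have hprod : ∀ p q, |φ p| * |φ q| ≤ ∑ i, φ i ^ 2 := fun p q => by
    have h2 : 2 * (|φ p| * |φ q|) ≤ φ p ^ 2 + φ q ^ 2 := by
      nlinarith [sq_nonneg (|φ p| - |φ q|), sq_abs (φ p), sq_abs (φ q)]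
    nlinarith [hs p, hs q, abs_nonneg (φ p), abs_nonneg (φ q)]
  rw [quadForm_eq_sum_entries, Finset.sum_mul]
  refine (Finset.abs_sum_le_sum_abs _ _).trans (Finset.sum_le_sum fun p _ => ?_)
  rw [Finset.sum_mul]
  refine (Finset.abs_sum_le_sum_abs _ _).trans (Finset.sum_le_sum fun q _ => ?_)
  rw [abs_mul, abs_mul]
  exact mul_le_mul_of_nonneg_left (hprod p q) (abs_nonneg _)

/-- The scalar matrix `a • 1` with `a > 0` is positive definite and its form is `a Σᵢ φᵢ²`. -/
private lemma smul_one_posDef_form {ι : Type} [Fintype ι] [DecidableEq ι] {a : ℝ} (ha : 0 < a) :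
    ((a • (1 : Matrix ι ι ℝ)).PosDef) ∧
      ∀ φ : ι → ℝ, φ ⬝ᵥ ((a • (1 : Matrix ι ι ℝ)) *ᵥ φ) = a * ∑ i, φ i ^ 2 := by
  have hform : ∀ φ : ι → ℝ, φ ⬝ᵥ ((a • (1 : Matrix ι ι ℝ)) *ᵥ φ) = a * ∑ i, φ i ^ 2 := fun φ => by
    rw [Matrix.smul_mulVec, Matrix.one_mulVec, dotProduct_smul, smul_eq_mul, dotProduct]
    congr 1
    exact Finset.sum_congr rfl fun i _ => by ring
  refine ⟨Matrix.PosDef.of_dotProduct_mulVec_pos ?_ fun φ hφ => ?_, hform⟩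
  · exact Matrix.isHermitian_iff_isSymm.2 (by unfold Matrix.IsSymm; simp)
  · simp only [star_trivial]
    rw [hform φ]
    obtain ⟨i, hi⟩ : ∃ i, φ i ≠ 0 := Function.ne_iff.1 hφ
    have : 0 < ∑ j, φ j ^ 2 := lt_of_lt_of_le (by positivity : 0 < φ i ^ 2)
      (Finset.single_le_sum (f := fun j => φ j ^ 2) (fun j _ => sq_nonneg _) (Finset.mem_univ i))
    positivity

/-- **Differentiation of Gaussian integrals along a precision path.** Let `t ↦ P(t)` be a path of
real matrices, positive definite at `t₀`, continuous at `t₀` together with a path `P'` which is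
its entrywise derivative on a neighbourhood of `t₀`.  For a measurable `F` of polynomial growth,
`t ↦ ∫ F e^{−½φᵀP(t)φ} dφ` has derivative `−½ ∫ (φᵀP'(t₀)φ) F e^{−½φᵀP(t₀)φ} dφ` at `t₀`
(differentiation under the integral sign; on a neighbourhood of `t₀` the form of `P(t)` stays
coercive, `φᵀP(t)φ ≥ (c/2) Σφᵢ²`, and the entries of `P'(t)` stay bounded, so the derivative of the
integrand is dominated by a product Gaussian times a polynomial). [folklore] -/
theorem hasDerivAt_gaussian_integral_path :
    ∀ (ι : Type) [Fintype ι] [DecidableEq ι] (P P' : ℝ → Matrix ι ι ℝ) (t₀ : ℝ), (P t₀).PosDef → ContinuousAt P t₀ → ContinuousAt P' t₀ → (∀ᶠ t in 𝓝 t₀, ∀ p q : ι, HasDerivAt (fun s : ℝ => P s p q) (P' t p q) t) → ∀ (m : ℕ) (K : ℝ) (F : (ι → ℝ) → ℝ), AEStronglyMeasurable F volume → (∀ φ : ι → ℝ, |F φ| ≤ K * (1 + ∑ i, φ i ^ 2) ^ m) → HasDerivAt (fun t : ℝ => ∫ φ : ι → ℝ, F φ * Real.exp (-(φ ⬝ᵥ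 (P t *ᵥ φ)) / 2)) (-(1 / 2) * ∫ φ : ι → ℝ, (φ ⬝ᵥ (P' t₀ *ᵥ φ)) * F φ * Real.exp (-(φ ⬝ᵥ (P t₀ *ᵥ φ)) / 2)) t₀ := by
  intro ι _ _ P P' t₀ hP₀ hPc hP'c hd m K F hFm hFb
  obtain ⟨c, hc, hcoer⟩ := posDef_coercive ι (P t₀) hP₀
  -- entries of a path continuous at `t₀` are continuous at `t₀`
  have hab : ∀ p q : ι, Continuous fun A : Matrix ι ι ℝ => A p q := fun p q =>
    (continuous_apply q).comp (continuous_apply p)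
  have hent : ∀ {A : ℝ → Matrix ι ι ℝ}, ContinuousAt A t₀ → ∀ p q : ι,
      Tendsto (fun s : ℝ => A s p q) (𝓝 t₀) (𝓝 (A t₀ p q)) := fun {A} hA p q =>
    ((hab p q).continuousAt.tendsto).comp hA
  -- the path stays close to `P t₀` near `t₀`
  set g : ℝ → ℝ := fun s => ∑ p, ∑ q, |(P s - P t₀) p q| with hgdef
  have hg : Tendsto g (𝓝 t₀) (𝓝 (g t₀)) :=
    tendsto_finsetSum _ fun p _ => tendsto_finsetSum _ fun q _ =>
      (hent (hPc.sub continuousAt_const) p q).abs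
  have hg0 : g t₀ = 0 := by simp [hgdef]
  rw [hg0] at hg
  have hev₂ : ∀ᶠ s in 𝓝 t₀, g s < c / 2 := hg.eventually_lt_const (by positivity)
  -- the entries of `P'` stay bounded near `t₀`
  set h : ℝ → ℝ := fun s => ∑ p, ∑ q, |P' s p q| with hhdef
  set Λ : ℝ := h t₀ + 1 with hΛ
  have hh : Tendsto h (𝓝 t₀) (𝓝 (h t₀)) :=
    tendsto_finsetSum _ fun p _ => tendsto_finsetSum _ fun q _ => (hent hP'c p q).abs
  have hh0 : 0 ≤ h t₀ := Finset.sum_nonneg fun p _ => Finset.sum_nonneg fun q _ => abs_nonneg _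
  have hΛ0 : 0 ≤ Λ := by rw [hΛ]; linarith
  have hev₃ : ∀ᶠ s in 𝓝 t₀, h s < Λ := hh.eventually_lt_const (by rw [hΛ]; linarith)
  -- the good neighbourhood of `t₀`
  have hS : ∀ᶠ t in 𝓝 t₀, (∀ p q : ι, HasDerivAt (fun s : ℝ => P s p q) (P' t p q) t) ∧ g t < c / 2 ∧ h t < Λ :=
    hd.and (hev₂.and hev₃)
  -- coercivity on the good neighbourhood
  have hnear : ∀ t : ℝ, g t < c / 2 → ∀ φ : ι → ℝ, c / 2 * ∑ i, φ i ^ 2 ≤ φ ⬝ᵥ (P t *ᵥ φ) := by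
    intro t ht φ
    have hs : 0 ≤ ∑ i, φ i ^ 2 := Finset.sum_nonneg fun i _ => sq_nonneg _
    have h1 := hcoer φ
    have h2 : |φ ⬝ᵥ ((P t - P t₀) *ᵥ φ)| ≤ g t * ∑ i, φ i ^ 2 := abs_quadForm_le_entries (P t - P t₀) φ
    have h3 : g t * ∑ i, φ i ^ 2 ≤ c / 2 * ∑ i, φ i ^ 2 := mul_le_mul_of_nonneg_right ht.le hs
    have h4 := neg_abs_le (φ ⬝ᵥ ((P t - P t₀) *ᵥ φ))
    have h5 : φ ⬝ᵥ (P t *ᵥ φ) = φ ⬝ᵥ (P t₀ *ᵥ φ) + φ ⬝ᵥ ((P t - P t₀) *ᵥ φ) := by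
      rw [Matrix.sub_mulVec, dotProduct_sub]; ring
    rw [h5]
    linarith
  -- the dominating function
  obtain ⟨hR, hRform⟩ := smul_one_posDef_form (ι := ι) (a := c / 2) (by positivity)
  set bound : (ι → ℝ) → ℝ := fun φ => (1 / 2 * Λ * |K| * (1 + ∑ i, φ i ^ 2) ^ (m + 1)) *
    Real.exp (-(φ ⬝ᵥ (((c / 2) • (1 : Matrix ι ι ℝ)) *ᵥ φ)) / 2) with hbound
  have hpoly_cont : Continuous fun φ : ι → ℝ => 1 / 2 * Λ * |K| * (1 + ∑ i, φ i ^ 2) ^ (m + 1) := by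
    fun_prop
  have hbound_int : Integrable bound := by
    refine integrable_polyGrowth_mul_gaussian ι _ hR (m + 1) (1 / 2 * Λ * |K|) _ hpoly_cont.aestronglyMeasurable
      fun φ => ?_
    have hs : 0 ≤ ∑ i, φ i ^ 2 := Finset.sum_nonneg fun i _ => sq_nonneg _
    rw [abs_of_nonneg (by positivity)]
  -- continuity of weights and quadratic forms in `φ`
  have hwcont : ∀ A : Matrix ι ι ℝ, Continuous fun φ : ι → ℝ => Real.exp (-(φ ⬝ᵥ (A *ᵥ φ)) / 2) := fun A => by
    refine Real.continuous_exp.comp ((Continuous.neg ?_).div_const _)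
    exact continuous_id.dotProduct (Continuous.matrix_mulVec continuous_const continuous_id)
  have hqcont : ∀ A : Matrix ι ι ℝ, Continuous fun φ : ι → ℝ => φ ⬝ᵥ (A *ᵥ φ) := fun A =>
    continuous_id.dotProduct (Continuous.matrix_mulVec continuous_const continuous_id)
  -- the derivative of the integrand
  set G' : ℝ → (ι → ℝ) → ℝ := fun t φ =>
    -(1 / 2) * ((φ ⬝ᵥ (P' t *ᵥ φ)) * F φ * Real.exp (-(φ ⬝ᵥ (P t *ᵥ φ)) / 2)) with hG'
  have hdiff : ∀ (φ : ι → ℝ) (t : ℝ), (∀ p q : ι, HasDerivAt (fun s : ℝ => P s p q) (P' t p q) t) →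
      HasDerivAt (fun s : ℝ => F φ * Real.exp (-(φ ⬝ᵥ (P s *ᵥ φ)) / 2)) (G' t φ) t := by
    intro φ t ht
    have h1 : HasDerivAt (fun s : ℝ => φ ⬝ᵥ (P s *ᵥ φ)) (φ ⬝ᵥ (P' t *ᵥ φ)) t := by
      have hsum := HasDerivAt.fun_sum (u := Finset.univ) fun p (_ : p ∈ Finset.univ) =>
        HasDerivAt.fun_sum (u := Finset.univ) fun q (_ : q ∈ Finset.univ) => (ht p q).mul_const (φ p * φ q)
      simp only [quadForm_eq_sum_entries]
      exact hsum
    have h2 := ((h1.fun_neg.div_const 2).exp).const_mul (F φ)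
    refine h2.congr_deriv ?_
    simp only [hG']
    ring
  have key := hasDerivAt_integral_of_dominated_loc_of_deriv_le (μ := (volume : Measure (ι → ℝ)))
    (F := fun t φ => F φ * Real.exp (-(φ ⬝ᵥ (P t *ᵥ φ)) / 2)) (F' := G') (x₀ := t₀)
    (bound := bound) hS ?_ ?_ ?_ ?_ hbound_int ?_
  · have hval : ∫ φ : ι → ℝ, G' t₀ φ = -(1 / 2) * ∫ φ : ι → ℝ, (φ ⬝ᵥ (P' t₀ *ᵥ φ)) * F φ * Real.exp (-(φ ⬝ᵥ (P t₀ *ᵥ φ)) / 2) := by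
      rw [hG']
      exact integral_const_mul _ _
    rw [← hval]
    exact key.2
  · exact Filter.Eventually.of_forall fun t => hFm.mul (hwcont (P t)).aestronglyMeasurable
  · exact integrable_polyGrowth_mul_gaussian ι (P t₀) hP₀ m K F hFm hFb
  · exact (aestronglyMeasurable_const.mul (((hqcont (P' t₀)).aestronglyMeasurable.mul hFm).mul
      (hwcont (P t₀)).aestronglyMeasurable))
  · refine Filter.Eventually.of_forall fun φ t ht => ?_
    simp only [Set.mem_setOf_eq] at ht
    obtain ⟨-, ht₂, ht₃⟩ := ht
    have hs : 0 ≤ ∑ i, φ i ^ 2 := Finset.sum_nonneg fun i _ => sq_nonneg _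
    have hK : |F φ| ≤ |K| * (1 + ∑ i, φ i ^ 2) ^ m :=
      (hFb φ).trans (mul_le_mul_of_nonneg_right (le_abs_self K) (by positivity))
    have hq' : |φ ⬝ᵥ (P' t *ᵥ φ)| ≤ h t * ∑ i, φ i ^ 2 := abs_quadForm_le_entries (P' t) φ
    have hq : |φ ⬝ᵥ (P' t *ᵥ φ)| ≤ Λ * (1 + ∑ i, φ i ^ 2) :=
      hq'.trans (mul_le_mul ht₃.le (by linarith) hs hΛ0)
    have hw : Real.exp (-(φ ⬝ᵥ (P t *ᵥ φ)) / 2) ≤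
        Real.exp (-(φ ⬝ᵥ (((c / 2) • (1 : Matrix ι ι ℝ)) *ᵥ φ)) / 2) := by
      rw [hRform φ]
      exact Real.exp_le_exp.2 (by have := hnear t ht₂ φ; linarith)
    rw [hG', hbound, Real.norm_eq_abs, abs_mul, abs_mul, abs_mul, Real.abs_exp,
      show |(-(1 / 2) : ℝ)| = 1 / 2 by norm_num]
    calc 1 / 2 * (|φ ⬝ᵥ (P' t *ᵥ φ)| * |F φ| * Real.exp (-(φ ⬝ᵥ (P t *ᵥ φ)) / 2))
        ≤ 1 / 2 * ((Λ * (1 + ∑ i, φ i ^ 2)) * (|K| * (1 + ∑ i, φ i ^ 2) ^ m) *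
            Real.exp (-(φ ⬝ᵥ (((c / 2) • (1 : Matrix ι ι ℝ)) *ᵥ φ)) / 2)) := by
          gcongr
      _ = (1 / 2 * Λ * |K| * (1 + ∑ i, φ i ^ 2) ^ (m + 1)) *
            Real.exp (-(φ ⬝ᵥ (((c / 2) • (1 : Matrix ι ι ℝ)) *ᵥ φ)) / 2) := by ring
  · refine Filter.Eventually.of_forall fun φ t ht => ?_
    simp only [Set.mem_setOf_eq] at ht
    exact hdiff φ t ht.1

/-- **Differentiation of Gaussian integrals along a covariance segment.** For `C(t) = C₀ + tB`
positive definite at `t₀` and a measurable `F` of polynomial growth, with `P = C(t₀)⁻¹`,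
`d/dt ∫ F e^{−½φᵀC(t)⁻¹φ} dφ |_{t₀} = ½ ∫ (φᵀ P B P φ) F e^{−½φᵀPφ} dφ`
(`hasDerivAt_gaussian_integral_path` with `d/dt C(t)⁻¹ = −C(t)⁻¹ B C(t)⁻¹`,
`hasDerivAt_matrix_inv_linear`; `C(t)` stays invertible near `t₀`). [folklore] -/
theorem hasDerivAt_gaussianCov_integral :
    ∀ (ι : Type) [Fintype ι] [DecidableEq ι] (C₀ B : Matrix ι ι ℝ) (t₀ : ℝ), (C₀ + t₀ • B).PosDef → ∀ (m : ℕ) (K : ℝ) (F : (ι → ℝ) → ℝ), AEStronglyMeasurable F volume → (∀ φ : ι → ℝ, |F φ| ≤ K * (1 + ∑ i, φ i ^ 2) ^ m) → HasDerivAt (fun t : ℝ => ∫ φ : ι → ℝ, F φ * Real.exp (-(φ ⬝ᵥ ((C₀ + t • B)⁻¹ *ᵥ φ)) / 2)) ((1 / 2) * ∫ φ : ι → ℝ, (φ ⬝ᵥ (((C₀ + t₀ • B)⁻¹ * B * (C₀ + t₀ • B)⁻¹) *ᵥ φ)) * F φ * Real.exp (-(φ ⬝ᵥ ((C₀ + t₀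 • B)⁻¹ *ᵥ φ)) / 2)) t₀ := by
  intro ι _ _ C₀ B t₀ hC m K F hFm hFb
  have hdet : IsUnit (C₀ + t₀ • B).det := (Matrix.isUnit_iff_isUnit_det _).1 hC.isUnit
  have hlin : Continuous fun s : ℝ => C₀ + s • B := continuous_const.add (continuous_id.smul continuous_const)
  have hPc : ContinuousAt (fun s : ℝ => (C₀ + s • B)⁻¹) t₀ := by
    have h := continuousAt_matrix_inv (C₀ + t₀ • B)
      (by simpa using NormedRing.inverse_continuousAt (Units.mk0 _ hdet.ne_zero))
    exact ContinuousAt.comp (f := fun s : ℝ => C₀ + s • B) (x := t₀) h hlin.continuousAt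
  have hP'c : ContinuousAt (fun s : ℝ => -((C₀ + s • B)⁻¹ * B * (C₀ + s • B)⁻¹)) t₀ :=
    ((hPc.mul continuousAt_const).mul hPc).neg
  have hev : ∀ᶠ s in 𝓝 t₀, (C₀ + s • B).det ≠ 0 :=
    hlin.matrix_det.continuousAt.eventually_ne hdet.ne_zero
  have hd : ∀ᶠ t in 𝓝 t₀, ∀ p q : ι, HasDerivAt (fun s : ℝ => (C₀ + s • B)⁻¹ p q)
      ((-((C₀ + t • B)⁻¹ * B * (C₀ + t • B)⁻¹)) p q) t :=
    hev.mono fun t ht p q => by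
      simpa only [Matrix.neg_apply] using
        hasDerivAt_matrix_inv_linear ι C₀ B t (isUnit_iff_ne_zero.2 ht) p q
  have h := hasDerivAt_gaussian_integral_path ι (fun s : ℝ => (C₀ + s • B)⁻¹)
    (fun s : ℝ => -((C₀ + s • B)⁻¹ * B * (C₀ + s • B)⁻¹)) t₀ hC.inv hPc hP'c hd m K F hFm hFb
  refine h.congr_deriv ?_
  have hneg : ∫ φ : ι → ℝ, (φ ⬝ᵥ ((-((C₀ + t₀ • B)⁻¹ * B * (C₀ + t₀ • B)⁻¹)) *ᵥ φ)) * F φ *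
      Real.exp (-(φ ⬝ᵥ ((C₀ + t₀ • B)⁻¹ *ᵥ φ)) / 2) =
      -∫ φ : ι → ℝ, (φ ⬝ᵥ (((C₀ + t₀ • B)⁻¹ * B * (C₀ + t₀ • B)⁻¹) *ᵥ φ)) * F φ *
      Real.exp (-(φ ⬝ᵥ ((C₀ + t₀ • B)⁻¹ *ᵥ φ)) / 2) := by
    rw [← integral_neg]
    refine integral_congr_ae (Filter.Eventually.of_forall fun φ => ?_)
    simp only [Matrix.neg_mulVec, dotProduct_neg]
    ring
  rw [hneg]
  ring

/-- **Stub HEAT — the Gaussian heat equation along a COVARIANCE segment.** For `C(t) = C₀ + tB`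
positive definite at `t₀` and `F` in the polynomial-growth class with two coordinate derivatives
(as in `hasDerivAt_gaussian_expect`, the PRECISION-segment version), the normalised Gaussian
expectation with precision `C(t)⁻¹` satisfies
`d/dt ⟨F⟩_{C(t)} |_{t₀} = ½ Σ_{a,b} B_{ab} ⟨∂_a∂_b F⟩_{C(t₀)}`: the derivative of the covariance
enters linearly and without sandwiches (`d/dt C(t)⁻¹ = −PBP`, `P = C(t₀)⁻¹`,
`hasDerivAt_gaussianCov_integral`; quotient rule; `gaussian_wick_quadForm` with the insertion `PBP`,
whose covariance sandwich `C (PBP) C = B` collapses and whose trace terms cancel between numerator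
and partition function).  Glimm–Jaffe (9.1.33); the symmetry of `B` is not used. [folklore] -/
theorem stub_gaussianCovHeat : ∀ (ι : Type) [Fintype ι] [DecidableEq ι] (C₀ B : Matrix ι ι ℝ) (t₀ : ℝ), (C₀ + t₀ • B).PosDef → B.IsSymm → ∀ (m : ℕ) (K : ℝ) (F : (ι → ℝ) → ℝ) (F₁ : ι → (ι → ℝ) → ℝ) (F₂ : ι → ι → (ι → ℝ) → ℝ), AEStronglyMeasurable F volume → (∀ a : ι, AEStronglyMeasurable (F₁ a) volume) → (∀ a b : ι, AEStronglyMeasurable (F₂ a b) volume) → (∀ φ : ι → ℝ, |F φ| ≤ K * (1 + ∑ i, φ i ^ 2) ^ m) → (∀ (a : ι) (φ : ι → ℝ), |F₁ a φ| ≤ K * (1 + ∑ i, φ i ^ 2) ^ m) → (∀ (a b : ι) (φ : ι → ℝ), |F₂ a b φ| ≤ K * (1 + ∑ i, φ i ^ 2) ^ m) → (∀ (a : ι) (φ : ι → ℝ), HasDerivAt (fun t : ℝ => F (Function.update φ a t)) (F₁ a φ) (φ a)) → (∀ (a b : ι) (φ : ι → ℝ), HasDerivAt (fun t : ℝ =>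 F₁ a (Function.update φ b t)) (F₂ a b φ) (φ b)) → HasDerivAt (fun t : ℝ => (∫ φ : ι → ℝ, F φ * Real.exp (-(φ ⬝ᵥ ((C₀ + t • B)⁻¹ *ᵥ φ)) / 2)) / ∫ φ : ι → ℝ, Real.exp (-(φ ⬝ᵥ ((C₀ + t • B)⁻¹ *ᵥ φ)) / 2)) ((1 / 2) * ∑ a : ι, ∑ b : ι, B a b * ((∫ φ : ι → ℝ, F₂ a b φ * Real.exp (-(φ ⬝ᵥ ((C₀ + t₀ • B)⁻¹ *ᵥ φ)) / 2)) / ∫ φ : ι → ℝ, Real.exp (-(φ ⬝ᵥ ((C₀ + t₀ • B)⁻¹ *ᵥ φ)) / 2))) t₀ := by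
  intro ι _ _ C₀ B t₀ hC _hB m K F F₁ F₂ hFm hF₁m hF₂m hFb hF₁b hF₂b hderiv hderiv₂
  set Q : Matrix ι ι ℝ := (C₀ + t₀ • B)⁻¹ with hQdef
  have hQ : Q.PosDef := hC.inv
  have hdet : IsUnit (C₀ + t₀ • B).det := (Matrix.isUnit_iff_isUnit_det _).1 hC.isUnit
  -- the covariance sandwich collapses: `Q⁻¹ (Q B Q) Q⁻¹ = B`
  have hQinv : Q⁻¹ = C₀ + t₀ • B := Matrix.nonsing_inv_nonsing_inv _ hdet
  have hsand : Q⁻¹ * (Q * B * Q) * Q⁻¹ = B := by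
    rw [hQinv, hQdef]
    calc (C₀ + t₀ • B) * ((C₀ + t₀ • B)⁻¹ * B * (C₀ + t₀ • B)⁻¹) * (C₀ + t₀ • B)
        = ((C₀ + t₀ • B) * (C₀ + t₀ • B)⁻¹) * B * ((C₀ + t₀ • B)⁻¹ * (C₀ + t₀ • B)) := by
          simp only [Matrix.mul_assoc]
      _ = B := by
          rw [Matrix.mul_nonsing_inv _ hdet, Matrix.nonsing_inv_mul _ hdet, Matrix.one_mul, Matrix.mul_one]
  -- derivatives of numerator and partition function
  have hN := hasDerivAt_gaussianCov_integral ι C₀ B t₀ hC m K F hFm hFb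
  have hZ' := hasDerivAt_gaussianCov_integral ι C₀ B t₀ hC 0 1 (fun _ => 1) aestronglyMeasurable_const
    (fun φ => by simp)
  have hZ : HasDerivAt (fun t : ℝ => ∫ φ : ι → ℝ, Real.exp (-(φ ⬝ᵥ ((C₀ + t • B)⁻¹ *ᵥ φ)) / 2))
      ((1 / 2) * ∫ φ : ι → ℝ, (φ ⬝ᵥ ((Q * B * Q) *ᵥ φ)) * Real.exp (-(φ ⬝ᵥ (Q *ᵥ φ)) / 2)) t₀ := by
    simpa only [one_mul, mul_one] using hZ'
  obtain ⟨hZpos, -⟩ := gaussian_second_moment ι Q hQ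
  -- Wick identities at `t₀` with the insertion `Q B Q`
  have hWF := gaussian_wick_quadForm ι Q hQ m K F F₁ F₂ hFm hF₁m hF₂m hFb hF₁b hF₂b hderiv hderiv₂ (Q * B * Q)
  have hW1 := gaussian_wick_quadForm ι Q hQ 0 1 (fun _ => 1) (fun _ _ => 0) (fun _ _ _ => 0)
    aestronglyMeasurable_const (fun _ => aestronglyMeasurable_const) (fun _ _ => aestronglyMeasurable_const)
    (fun φ => by simp) (fun _ φ => by simp) (fun _ _ φ => by simp)
    (fun a φ => by simpa using hasDerivAt_const (φ a) (1 : ℝ))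
    (fun a b φ => by simpa using hasDerivAt_const (φ b) (0 : ℝ)) (Q * B * Q)
  simp only [mul_one, one_mul, zero_mul, integral_zero, mul_zero, Finset.sum_const_zero, add_zero] at hW1
  rw [hsand] at hWF
  -- quotient rule
  have hquot := hN.fun_div hZ hZpos.ne'
  refine hquot.congr_deriv ?_
  rw [hWF, hW1]
  set Z : ℝ := ∫ φ : ι → ℝ, Real.exp (-(φ ⬝ᵥ (Q *ᵥ φ)) / 2) with hZdef
  set T : ℝ := ∑ p, ∑ q, (Q * B * Q) p q * Q⁻¹ p q with hT
  set N : ℝ := ∫ φ : ι → ℝ, F φ * Real.exp (-(φ ⬝ᵥ (Q *ᵥ φ)) / 2) with hNdef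
  have hsum : ∑ a, ∑ b, B a b *
      ((∫ φ : ι → ℝ, F₂ a b φ * Real.exp (-(φ ⬝ᵥ (Q *ᵥ φ)) / 2)) / Z) =
      (∑ a, ∑ b, B a b * ∫ φ : ι → ℝ, F₂ a b φ * Real.exp (-(φ ⬝ᵥ (Q *ᵥ φ)) / 2)) / Z := by
    rw [Finset.sum_div]
    refine Finset.sum_congr rfl fun a _ => ?_
    rw [Finset.sum_div]
    exact Finset.sum_congr rfl fun b _ => (mul_div_assoc _ _ _).symm
  rw [hsum]
  field_simp
  ring

end Summit.QuantumFields.YangMills.Theorems.AnchorGap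

end
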